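import Summits.ABC.StewartYu.PadicG3TwoFunctions
import Summits.ABC.StewartYu.MonomialDenominators
import Summits.ABC.StewartYu.DescentLiouvilleQ
import HarnessLib

/-!
# Cell abc-stewartyu, Gen-3 frame at `p = 2` (crux `Y07Two`, stmt-ABC-19659), layer F1 (values): denominators,
# sizes and the LIOUVILLE INEQUALITY for the rational values `φ_τ(x)` at the integer points

`Summits/ABC/StewartYu/PadicG3TwoValues.lean` — cell `abc-stewartyu` (HOME `run/shared/lean/pub/abc-stewartyu/`),
route `PadicPrimesKummerThird`, seat p3 (g5), F-two LEAD (layer plan HOME/p3/memo-09 §3, F1 "values II").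
Theorems (and one exponent-vector abbreviation) on the M2 datum `TwoSetup`; no named fact.

The rational value of the Gen-3 auxiliary function at an integer point (`PadicG3TwoFunctions.g3φ`) is
`φ_τ(x) = ∑_{i∈B} pᵢ · (Hasse_{t₀} Rᵢ)(x) · ∏ⱼ zγⱼ(i)^{tⱼ} · ∏ⱼ αⱼ^{uᵢⱼ x}·θ^{u_θ x}`.  Its three factors are
cleared separately:
* the `Y₀`-weight by the frame's `den₀` (hypothesis: `den₀·(Hasse_{t₀} Rᵢ)(x) ∈ ℤ`, `|·| ≤ M₀` — Fel'dman's
  `Δ`-basis, p2-g4 `FeldmanZeroDirectionWeights`);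
* the directional monomial by `b_θ^{|t|}`: `b_θ^{|t|}·∏ zγⱼ^{tⱼ} = ∏ 𝔛ⱼ^{tⱼ} ∈ ℤ` (`bθ_pow_mul_zγpow`), of size
  `≤ Xb^{|t|}` when `|𝔛ⱼ| ≤ Xb`;
* the monomial in the generators by `MonomialDen.monDen` of ALL `d + 1` generators with the exponent box
  `Eₖ = Dₖ·|x|` (`exists_int_monDen_mul_zmon`), of size `≤ monDen²`, `log monDen ≤ 2|x|·∑ Dₖ h(allₖ)`.
Hence `D·φ_τ(x) ∈ ℤ` with `D = den₀·|b_θ|^{|t|}·monDen` and `|D·φ_τ(x)| ≤ #B·P·M₀·Xb^{|t|}·monDen²`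
(`exists_int_clear_mul_g3φ`), and by the product formula (`SetupQ.padicNorm_ge_of_int_mul`) the
**LIOUVILLE INEQUALITY** `g3φ_eq_zero_of_norm_lt`:
`‖φ_τ(x)‖₂ < 1/(#B·P·M₀·Xb^{|t|}·monDen²) ⇒ φ_τ(x) = 0` — the step that turns "small" into "zero" at every
point of the `2`-adic extrapolation (Yu 2013 (5.40)–(5.41); M2 analogue `SetupQ.coreSum_eq_zero_of_padicNorm_lt`).

WHAT THIS IS NOT: no Schwarz step, no Siegel step; no crux moves.

References: K. Yu, Acta Math. 211 (2013), (5.35)–(5.41); Yu. V. Nesterenko, LNM 1819 (2003), §3.2.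
-/

noncomputable section

open Finset Polynomial
open Literature.NumberTheory.Transcendental
open Literature.NumberTheory.Transcendental.CW77.Setup (Tau tauNorm)

namespace Summit.ABC.StewartYu

namespace TwoSetup

variable (S : TwoSetup) {ι : Type*} (R : ι → ℚ[X]) (u : ι → Fin S.d → ℤ) (uθ : ι → ℤ)

/-! ### The monomial in ALL generators -/

/-- The exponent vector of `zmon(uᵢ, u_θᵢ, x)` over all `d + 1` generators `all = (α, θ)`. [folklore] -/
abbrev allExp (v : Fin S.d → ℤ) (vθ : ℤ) (x : ℤ) : Fin (S.d + 1) → ℤ :=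
  Fin.snoc (fun j => v j * x) (vθ * x)

/-- `zmon = ∏ₖ allₖ^{allExpₖ}`. [folklore] -/
theorem zmon_eq_prod_all (v : Fin S.d → ℤ) (vθ : ℤ) (x : ℤ) :
    S.zmon v vθ x = ∏ k : Fin (S.d + 1), S.toQ.all k ^ S.allExp v vθ x k := by
  unfold zmon allExp SetupQ.all
  rw [Fin.prod_univ_castSucc]
  simp only [Fin.snoc_castSucc, Fin.snoc_last]

/-- The exponent box at the point `x`: `Eₖ = Dₖ·|x|` (`D = (D₁..D_d; D_θ)`). [folklore] -/
abbrev boxExp (Dbox : Fin S.d → ℕ) (Dθ : ℕ) (x : ℤ) : Fin (S.d + 1) → ℕ :=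
  Fin.snoc (fun j => Dbox j * x.natAbs) (Dθ * x.natAbs)

/-- In the box, `|allExpₖ| ≤ boxExpₖ`. [folklore] -/
theorem abs_allExp_le {Dbox : Fin S.d → ℕ} {Dθ : ℕ} {v : Fin S.d → ℤ} {vθ : ℤ}
    (hv : ∀ j, |v j| ≤ (Dbox j : ℤ)) (hvθ : |vθ| ≤ (Dθ : ℤ)) (x : ℤ) (k : Fin (S.d + 1)) :
    |S.allExp v vθ x k| ≤ (S.boxExp Dbox Dθ x k : ℤ) := by
  unfold allExp boxExp
  refine Fin.lastCases ?_ (fun j => ?_) k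
  · simp only [Fin.snoc_last]
    push_cast
    rw [abs_mul]
    exact mul_le_mul_of_nonneg_right hvθ (abs_nonneg _)
  · simp only [Fin.snoc_castSucc]
    push_cast
    rw [abs_mul]
    exact mul_le_mul_of_nonneg_right (hv j) (abs_nonneg _)

/-- **The monomial cleared**: `monDen(all, boxExp x)·zmon ∈ ℤ` with `|·| ≤ monDen²`.
[cite: Nesterenko2003, §3.2; shape only] -/
theorem exists_int_monDen_mul_zmon {Dbox : Fin S.d → ℕ} {Dθ : ℕ} {v : Fin S.d → ℤ} {vθ : ℤ}
    (hv : ∀ j, |v j| ≤ (Dbox j : ℤ)) (hvθ : |vθ| ≤ (Dθ : ℤ)) (x : ℤ) :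
    ∃ z : ℤ, ((MonomialDen.monDen S.toQ.all (S.boxExp Dbox Dθ x) : ℕ) : ℚ) * S.zmon v vθ x = z ∧
      |z| ≤ ((MonomialDen.monDen S.toQ.all (S.boxExp Dbox Dθ x) : ℤ)) ^ 2 := by
  rw [S.zmon_eq_prod_all]
  exact MonomialDen.exists_int_monDen_mul_prod_zpow S.toQ.all S.toQ.all_ne _ _
    (S.abs_allExp_le hv hvθ x)

/-! ### The directional monomial cleared by `b_θ^{|t|}` -/

/-- `b_θ^{∑ tⱼ}·∏ zγⱼ^{tⱼ} = ∏ 𝔛ⱼ^{tⱼ}`. [folklore] -/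
theorem bθ_pow_mul_zγpow (i : ι) (t : Fin S.d → ℕ) :
    (S.bθ : ℚ) ^ (∑ j, t j) * S.zγpow u uθ i t = ∏ j, (S.dirScalar (u i) (uθ i) j : ℚ) ^ t j := by
  unfold zγpow
  rw [← Finset.prod_pow_eq_pow_sum, ← Finset.prod_mul_distrib]
  refine Finset.prod_congr rfl fun j _ => ?_
  rw [← mul_pow, S.bθ_mul_zγ]

/-- `|∏ 𝔛ⱼ^{tⱼ}| ≤ Xb^{∑ tⱼ}` when `|𝔛ⱼ| ≤ Xb`. [folklore] -/
theorem abs_prod_dirScalar_pow_le (i : ι) (t : Fin S.d → ℕ) {Xb : ℤ}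
    (hX : ∀ j, |S.dirScalar (u i) (uθ i) j| ≤ Xb) :
    |∏ j, S.dirScalar (u i) (uθ i) j ^ t j| ≤ Xb ^ (∑ j, t j) := by
  rw [Finset.abs_prod, ← Finset.prod_pow_eq_pow_sum]
  refine Finset.prod_le_prod (fun j _ => abs_nonneg _) fun j _ => ?_
  rw [abs_pow]
  exact pow_le_pow_left₀ (abs_nonneg _) (hX j) _

/-- `|𝔛ⱼ(v, v_θ)| ≤ |b_θ|·Dⱼ + |bⱼ|·D_θ` in the box. [folklore] -/
theorem abs_dirScalar_le {Dbox : Fin S.d → ℕ} {Dθ : ℕ} {v : Fin S.d → ℤ} {vθ : ℤ}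
    (hv : ∀ j, |v j| ≤ (Dbox j : ℤ)) (hvθ : |vθ| ≤ (Dθ : ℤ)) (j : Fin S.d) :
    |S.dirScalar v vθ j| ≤ |S.bθ| * Dbox j + |S.b j| * Dθ := by
  unfold dirScalar
  calc |S.bθ * v j - S.b j * vθ| ≤ |S.bθ * v j| + |S.b j * vθ| := abs_sub _ _
    _ = |S.bθ| * |v j| + |S.b j| * |vθ| := by rw [abs_mul, abs_mul]
    _ ≤ |S.bθ| * Dbox j + |S.b j| * Dθ :=
        add_le_add (mul_le_mul_of_nonneg_left (hv j) (abs_nonneg _))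
          (mul_le_mul_of_nonneg_left hvθ (abs_nonneg _))

/-! ### The value cleared, and the Liouville inequality -/

/-- **One coefficient cleared**: with `den₀·(Hasse_{t₀} Rᵢ)(x) = z₀ ∈ ℤ`, `|z₀| ≤ M₀`, `|𝔛ⱼ(i)| ≤ Xb`, and
the exponent box: `D·[(Hasse_{t₀} Rᵢ)(x)·∏ zγⱼ^{tⱼ}·zmonᵢ(x)] ∈ ℤ`, `|·| ≤ M₀·Xb^{|t|}·monDen²`,
`D = den₀·|b_θ|^{|t|}·monDen`. [cite: Yu2013, (5.35); shape only] -/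
theorem exists_int_clear_mul_coef {Dbox : Fin S.d → ℕ} {Dθ : ℕ} (i : ι)
    (hu : ∀ j, |u i j| ≤ (Dbox j : ℤ)) (huθ : |uθ i| ≤ (Dθ : ℤ))
    (τ : Tau S.d) (x : ℤ) {den₀ : ℕ} {M₀ : ℤ}
    (hR : ∃ z₀ : ℤ, (den₀ : ℚ) * (hasseDeriv τ.1 (R i)).eval (x : ℚ) = z₀ ∧ |z₀| ≤ M₀)
    {Xb : ℤ} (hX : ∀ j, |S.dirScalar (u i) (uθ i) j| ≤ Xb) :
    ∃ z : ℤ, ((den₀ * S.bθ.natAbs ^ (∑ j, τ.2 j) *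
        MonomialDen.monDen S.toQ.all (S.boxExp Dbox Dθ x) : ℕ) : ℚ) *
        ((hasseDeriv τ.1 (R i)).eval (x : ℚ) * S.zγpow u uθ i τ.2 * S.zmon (u i) (uθ i) x) = z ∧
      |z| ≤ M₀ * Xb ^ (∑ j, τ.2 j) * ((MonomialDen.monDen S.toQ.all (S.boxExp Dbox Dθ x) : ℤ)) ^ 2 := by
  obtain ⟨z₀, hz₀, hz₀le⟩ := hR
  obtain ⟨z₂, hz₂, hz₂le⟩ := S.exists_int_monDen_mul_zmon hu huθ x
  set z₁ : ℤ := ∏ j, S.dirScalar (u i) (uθ i) j ^ τ.2 j with hz₁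
  have hz₁q : ((S.bθ.natAbs ^ (∑ j, τ.2 j) : ℕ) : ℚ) * S.zγpow u uθ i τ.2 = (S.bθ.sign : ℚ) ^ (∑ j, τ.2 j) * z₁ := by
    -- `|b_θ|^{|t|} = sign(b_θ)^{|t|} · b_θ^{|t|}`
    have hsgn : ((S.bθ.natAbs : ℕ) : ℚ) = (S.bθ.sign : ℚ) * S.bθ := by
      rw [Nat.cast_natAbs]; push_cast
      rw [← Int.cast_abs, ← Int.sign_mul_self_eq_abs]; push_cast; ring
    push_cast
    rw [hsgn, mul_pow, mul_assoc, S.bθ_pow_mul_zγpow, hz₁]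
    push_cast; ring
  have hz₁le : |z₁| ≤ Xb ^ (∑ j, τ.2 j) := S.abs_prod_dirScalar_pow_le u uθ i τ.2 hX
  have hsgn1 : |(S.bθ.sign : ℤ) ^ (∑ j, τ.2 j)| = 1 := by
    rw [abs_pow]
    have : |S.bθ.sign| = 1 := by
      rcases lt_or_gt_of_ne S.bθ_ne with h | h
      · rw [Int.sign_eq_neg_one_of_neg h]; rfl
      · rw [Int.sign_eq_one_of_pos h]; rfl
    rw [this, one_pow]
  refine ⟨z₀ * (S.bθ.sign ^ (∑ j, τ.2 j) * z₁) * z₂, ?_, ?_⟩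
  · push_cast
    have e1 := hz₀
    have e2 := hz₁q
    have e3 := hz₂
    push_cast at e2 e3
    calc ((den₀ : ℚ) * ((S.bθ.natAbs : ℕ) : ℚ) ^ (∑ j, τ.2 j) *
          (MonomialDen.monDen S.toQ.all (S.boxExp Dbox Dθ x) : ℚ)) *
          ((hasseDeriv τ.1 (R i)).eval (x : ℚ) * S.zγpow u uθ i τ.2 * S.zmon (u i) (uθ i) x)
        = ((den₀ : ℚ) * (hasseDeriv τ.1 (R i)).eval (x : ℚ)) *
          ((((S.bθ.natAbs : ℕ) : ℚ) ^ (∑ j, τ.2 j)) * S.zγpow u uθ i τ.2) *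
          ((MonomialDen.monDen S.toQ.all (S.boxExp Dbox Dθ x) : ℚ) * S.zmon (u i) (uθ i) x) := by ring
      _ = (z₀ : ℚ) * ((S.bθ.sign : ℚ) ^ (∑ j, τ.2 j) * z₁) * z₂ := by rw [e1, e2, e3]
  · have h0 : (0 : ℤ) ≤ M₀ := (abs_nonneg _).trans hz₀le
    rw [abs_mul, abs_mul, abs_mul, hsgn1, one_mul]
    have hXb : (0 : ℤ) ≤ Xb ^ (∑ j, τ.2 j) := (abs_nonneg _).trans hz₁le
    calc |z₀| * |z₁| * |z₂| ≤ M₀ * Xb ^ (∑ j, τ.2 j) * |z₂| := by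
          refine mul_le_mul_of_nonneg_right ?_ (abs_nonneg _)
          exact mul_le_mul hz₀le hz₁le (abs_nonneg _) h0
      _ ≤ M₀ * Xb ^ (∑ j, τ.2 j) * ((MonomialDen.monDen S.toQ.all (S.boxExp Dbox Dθ x) : ℤ)) ^ 2 :=
          mul_le_mul_of_nonneg_left hz₂le (mul_nonneg h0 hXb)

/-- **The value cleared**: `D·φ_τ(x) ∈ ℤ` and `|φ_τ(x)| ≤ #B·P·M₀·Xb^{|t|}·monDen² / D` — stated as the two
hypotheses of the product formula. [cite: Yu2013, (5.35)–(5.39); shape only] -/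
theorem exists_int_clear_mul_g3φ {Dbox : Fin S.d → ℕ} {Dθ : ℕ} (B : Finset ι) (p : ι → ℤ)
    (hu : ∀ i ∈ B, ∀ j, |u i j| ≤ (Dbox j : ℤ)) (huθ : ∀ i ∈ B, |uθ i| ≤ (Dθ : ℤ))
    (τ : Tau S.d) (x : ℤ) {den₀ : ℕ} {M₀ : ℤ}
    (hR : ∀ i ∈ B, ∃ z₀ : ℤ, (den₀ : ℚ) * (hasseDeriv τ.1 (R i)).eval (x : ℚ) = z₀ ∧ |z₀| ≤ M₀)
    {Xb : ℤ} (hX : ∀ i ∈ B, ∀ j, |S.dirScalar (u i) (uθ i) j| ≤ Xb) {P : ℤ} (hP : ∀ i ∈ B, |p i| ≤ P) :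
    ∃ z : ℤ, ((den₀ * S.bθ.natAbs ^ (∑ j, τ.2 j) *
        MonomialDen.monDen S.toQ.all (S.boxExp Dbox Dθ x) : ℕ) : ℚ) * S.g3φ R u uθ B p τ x = z ∧
      |z| ≤ B.card * P * (M₀ * Xb ^ (∑ j, τ.2 j) *
        ((MonomialDen.monDen S.toQ.all (S.boxExp Dbox Dθ x) : ℤ)) ^ 2) := by
  classical
  have hcoef : ∀ i ∈ B, ∃ z : ℤ, ((den₀ * S.bθ.natAbs ^ (∑ j, τ.2 j) *
        MonomialDen.monDen S.toQ.all (S.boxExp Dbox Dθ x) : ℕ) : ℚ) *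
        ((hasseDeriv τ.1 (R i)).eval (x : ℚ) * S.zγpow u uθ i τ.2 * S.zmon (u i) (uθ i) x) = z ∧
      |z| ≤ M₀ * Xb ^ (∑ j, τ.2 j) * ((MonomialDen.monDen S.toQ.all (S.boxExp Dbox Dθ x) : ℤ)) ^ 2 :=
    fun i hi => S.exists_int_clear_mul_coef R u uθ i (hu i hi) (huθ i hi) τ x (hR i hi) (hX i hi)
  choose! z hz hzle using hcoef
  refine ⟨∑ i ∈ B, p i * z i, ?_, ?_⟩
  · unfold g3φ
    rw [Finset.mul_sum]
    push_cast
    refine Finset.sum_congr rfl fun i hi => ?_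
    have h := hz i hi
    push_cast at h
    calc ((den₀ : ℚ) * ((S.bθ.natAbs : ℕ) : ℚ) ^ (∑ j, τ.2 j) *
          (MonomialDen.monDen S.toQ.all (S.boxExp Dbox Dθ x) : ℚ)) *
          ((p i : ℚ) * (hasseDeriv τ.1 (R i)).eval (x : ℚ) * S.zγpow u uθ i τ.2 * S.zmon (u i) (uθ i) x)
        = (p i : ℚ) * (((den₀ : ℚ) * ((S.bθ.natAbs : ℕ) : ℚ) ^ (∑ j, τ.2 j) *
          (MonomialDen.monDen S.toQ.all (S.boxExp Dbox Dθ x) : ℚ)) *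
          ((hasseDeriv τ.1 (R i)).eval (x : ℚ) * S.zγpow u uθ i τ.2 * S.zmon (u i) (uθ i) x)) := by ring
      _ = (p i : ℚ) * (z i : ℚ) := by rw [h]
  · calc |∑ i ∈ B, p i * z i| ≤ ∑ i ∈ B, |p i * z i| := Finset.abs_sum_le_sum_abs _ _
      _ ≤ ∑ i ∈ B, P * (M₀ * Xb ^ (∑ j, τ.2 j) *
            ((MonomialDen.monDen S.toQ.all (S.boxExp Dbox Dθ x) : ℤ)) ^ 2) := by
          refine Finset.sum_le_sum fun i hi => ?_
          rw [abs_mul]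
          have hP0 : (0 : ℤ) ≤ P := (abs_nonneg _).trans (hP i hi)
          exact mul_le_mul (hP i hi) (hzle i hi) (abs_nonneg _) hP0
      _ = B.card * P * (M₀ * Xb ^ (∑ j, τ.2 j) *
            ((MonomialDen.monDen S.toQ.all (S.boxExp Dbox Dθ x) : ℤ)) ^ 2) := by
          rw [Finset.sum_const, nsmul_eq_mul]; ring

/-- **THE LIOUVILLE INEQUALITY AT THE INTEGER POINTS** (small ⇒ zero): in the box, with the frame's
`Y₀`-weight data `den₀, M₀`, directional bound `Xb` and coefficient bound `P`, if
`‖φ_τ(x)‖₂ < 1/(#B·P·M₀·Xb^{|t|}·monDen(all, boxExp x)²)` then `φ_τ(x) = 0`.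
[cite: Yu2013, (5.40)–(5.41); shape only] -/
theorem g3φ_eq_zero_of_norm_lt {Dbox : Fin S.d → ℕ} {Dθ : ℕ} (B : Finset ι) (p : ι → ℤ)
    (hu : ∀ i ∈ B, ∀ j, |u i j| ≤ (Dbox j : ℤ)) (huθ : ∀ i ∈ B, |uθ i| ≤ (Dθ : ℤ))
    (τ : Tau S.d) (x : ℤ) {den₀ : ℕ} (hden₀ : 1 ≤ den₀) {M₀ : ℤ}
    (hR : ∀ i ∈ B, ∃ z₀ : ℤ, (den₀ : ℚ) * (hasseDeriv τ.1 (R i)).eval (x : ℚ) = z₀ ∧ |z₀| ≤ M₀)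
    {Xb : ℤ} (hX : ∀ i ∈ B, ∀ j, |S.dirScalar (u i) (uθ i) j| ≤ Xb) {P : ℤ} (hP : ∀ i ∈ B, |p i| ≤ P)
    {K : ℝ} (hK : (B.card : ℝ) * P * (M₀ * (Xb : ℝ) ^ (∑ j, τ.2 j) *
      ((MonomialDen.monDen S.toQ.all (S.boxExp Dbox Dθ x) : ℝ)) ^ 2) ≤ K) (hK0 : 0 < K)
    (hlt : ‖((S.g3φ R u uθ B p τ x : ℚ) : ℚ_[2])‖ < 1 / K) :
    S.g3φ R u uθ B p τ x = 0 := by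
  classical
  by_contra hne
  have hmon1 : 1 ≤ MonomialDen.monDen S.toQ.all (S.boxExp Dbox Dθ x) :=
    MonomialDen.one_le_monDen _ S.toQ.all_ne _
  have hb1 : 1 ≤ S.bθ.natAbs := Int.natAbs_pos.mpr S.bθ_ne
  have hD1 : 1 ≤ den₀ * S.bθ.natAbs ^ (∑ j, τ.2 j) * MonomialDen.monDen S.toQ.all (S.boxExp Dbox Dθ x) :=
    one_le_mul (one_le_mul hden₀ (Nat.one_le_pow _ _ hb1)) hmon1
  obtain ⟨z, hz, hzle⟩ := S.exists_int_clear_mul_g3φ R u uθ B p hu huθ τ x hR hX hP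
  have hDpos : (0 : ℝ) < ((den₀ * S.bθ.natAbs ^ (∑ j, τ.2 j) *
      MonomialDen.monDen S.toQ.all (S.boxExp Dbox Dθ x) : ℕ) : ℝ) := by
    exact_mod_cast (show 0 < den₀ * S.bθ.natAbs ^ (∑ j, τ.2 j) *
      MonomialDen.monDen S.toQ.all (S.boxExp Dbox Dθ x) by omega)
  -- `|φ| ≤ K / D`
  have hφ : |((S.g3φ R u uθ B p τ x : ℚ) : ℝ)| ≤ K / ((den₀ * S.bθ.natAbs ^ (∑ j, τ.2 j) *
      MonomialDen.monDen S.toQ.all (S.boxExp Dbox Dθ x) : ℕ) : ℝ) := by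
    rw [le_div_iff₀ hDpos]
    have h2 : (((den₀ * S.bθ.natAbs ^ (∑ j, τ.2 j) *
        MonomialDen.monDen S.toQ.all (S.boxExp Dbox Dθ x) : ℕ) : ℝ)) *
        ((S.g3φ R u uθ B p τ x : ℚ) : ℝ) = (z : ℝ) := by
      have := congrArg (fun q : ℚ => (q : ℝ)) hz
      push_cast at this ⊢
      exact this
    have h1 : |((S.g3φ R u uθ B p τ x : ℚ) : ℝ)| * (((den₀ * S.bθ.natAbs ^ (∑ j, τ.2 j) *
        MonomialDen.monDen S.toQ.all (S.boxExp Dbox Dθ x) : ℕ) : ℝ)) = |(z : ℝ)| := by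
      rw [← h2, abs_mul, Nat.abs_cast, mul_comm]
    rw [h1]
    have hzR : |(z : ℝ)| ≤ (B.card : ℝ) * P * (M₀ * (Xb : ℝ) ^ (∑ j, τ.2 j) *
        ((MonomialDen.monDen S.toQ.all (S.boxExp Dbox Dθ x) : ℝ)) ^ 2) := by
      have := (Int.cast_le (R := ℝ)).mpr hzle
      push_cast at this
      linarith
    exact hzR.trans hK
  have hge := SetupQ.padicNorm_ge_of_int_mul (p := 2) hne hD1 ⟨z, hz⟩ hφ
  have hKD : (((den₀ * S.bθ.natAbs ^ (∑ j, τ.2 j) *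
      MonomialDen.monDen S.toQ.all (S.boxExp Dbox Dθ x) : ℕ) : ℝ)) *
      (K / ((den₀ * S.bθ.natAbs ^ (∑ j, τ.2 j) *
        MonomialDen.monDen S.toQ.all (S.boxExp Dbox Dθ x) : ℕ) : ℝ)) = K := by
    field_simp
  rw [hKD] at hge
  exact absurd hge (not_le.mpr hlt)

end TwoSetup

end Summit.ABC.StewartYu

end
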